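import Summits.BirchSwinnertonDyer.BirchSwinnertonDyer.Theses.PrintX10b
import Summits.BirchSwinnertonDyer.BirchSwinnertonDyer.Theorems.PrintX10bHowardRoad
import HarnessLib

/-!
# Line `composite-transfer-x10b` on crux stmt-BirchSwinnertonDyer-23730 `TwoSidedLinkAnyClassNumberX10b`
(route PrintX10b, r304 = B₃; registry crux decl
`Summit.BirchSwinnertonDyer.BirchSwinnertonDyer.Theses.PrintX10b.TwoSidedLinkAnyClassNumberX10b`).

TRANSFER (lens «transfer», seat bsd-idea-5 g0) of row 9's registered birth skeleton `B_birth`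
(bsd-idea-2 line2, crux stmt-23162 `…Theses.TorsionLayerDescent.TwoSidedLinkAnyClassNumber`, `p ≥ 5`)
to the `p = 3` twin. Dictionary: `Rank1Residual.ClassX9 W p ↦ ClassX10 W p ∧ ¬ Surj W 3 ∧ ¬ W.HasCM`
(`hX.goodOrd`, `hX.three_le` replace `obtain ⟨-, hp5, hgood, hord, -, -⟩`), route item
`TorsionLayerDescent.DescentPrintFacts` (.1 = JSW Thm. 3.3.1) ↦ route PrintX10b's by-name item
`JSWAnticyclotomicControl` (stmt-20535); the σ-bridge (`PrintX9HowardIMCLink` §1) transfers VERBATIM —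
JSW 2017 Thm. 3.3.1 is stated for `p ≥ 3` and is class-number-free.

B₃ ⇐ B₃¹ (3 ∣ h_K) ∧ B₃⁰ (3 ∤ h_K) ∧ (JSW 3.3.1 → B₃¹ → B₃⁰ → B₃):
* `stub_compositeValuationThree_divisibleClassNumber` (THE content, beyond print): the valuation form of
  the composite "Yan–Zhu Thm. 5.7 (1) + Thm. 5.9 + BCS Prop. 4.2.2 + CGLS Thm. 5.1.3 GIVEN Howard's
  containment" at `p = 3` on frames with `3 ∣ h_K` — row 9's `Stmt.stub_compositeValuationNoClassNumber`
  instantiated at `p = 3` and restricted to the divisible regime. Where `3 ∣ h_K` bites: ONLY the typed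
  transfer Thm. 5.9 (`Thm57Hypotheses.not_dvd_classNumber`, the tree Heegner-family vocabulary's standing
  hypothesis; print — Yan–Zhu §5.2, BCK21 §1.1/§4 — has NO class-number hypothesis), i.e. the
  identification `heegnerModule D F ∼ Λκ_∞` at positive torsion depth (the SAME module comparison as line
  `torsion-depth-x10b` on the sister crux 23729) and the `h_K`-factor of `𝓛_p^Gr = h_K·𝓛_𝔭(K)′·𝓛^II`
  (Yan–Zhu Def. 3.10) inside the proof of Thm. 5.7 (1). First non-transferring input at `3`: the
  Beilinson–Flach explicit reciprocity law / Ohta behind Thm. 5.7 (1) (registry flag `YZ26@3-BF-ERL-Ohta`).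
* `stub_compositeValuationThree_coprimeClassNumber` (PRINT modulo the cite-only composite fact): the same
  at `3 ∤ h_K` — in the kernel `stub_compositeValuationThree_coprimeClassNumber_of_composite` below
  (= `YanZhu2026.hasCharValuationAt_of_heegnerDivisibility` at `p = 3`).
* `TwoSidedLinkAnyClassNumberX10b_of` (JSW → B₃¹ → B₃⁰ → B₃): PROVED (no sorry) — B_birth's σ-bridge.
BSD is not proved by any of this.
-/

set_option linter.dupNamespace false
set_option autoImplicit false

noncomputable section

open scoped Classical

open WeierstrassCurve NumberField IsDedekindDomain Field Literature.NumberTheory.EllipticCurves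
  Literature.NumberTheory.EllipticCurves.ModularForms Literature.NumberTheory.EllipticCurves.YanZhu2026
  Literature.NumberTheory.EllipticCurves.JetchevSkinnerWan2017 Literature.NumberTheory.EllipticCurves.Castella2018

open Summit.BirchSwinnertonDyer.Rank1Residual
open Literature.NumberTheory.EllipticCurves.Rank1Residual (ClassX10 Surj)

namespace Summit.BirchSwinnertonDyer.BirchSwinnertonDyer.Cruxes.TwoSidedLinkAnyClassNumberX10b.CompositeTransferX10b

/-! ## Stub statements as named propositions -/

/-- **B₃¹ — the composite valuation identity at `p = 3` on frames with `3 ∣ h_K`** (granted Howard's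
containment at the frame and ONE generator `G` of `Char_Λ(𝒳_{𝓕_Gr})` with `G(0) ≠ 0`:
`ord_3 G(0) = 2·(ord_3(1 − a_3 + 3) − 1 + ord_3 log_ω P_K) − 2·ord_3 c(Dt)`). Row 9's
`Stmt.stub_compositeValuationNoClassNumber` at `p = 3`, divisible regime. Beyond print BY NAME only
through the typed vocabulary (`Thm57Hypotheses.not_dvd_classNumber`); flag `YZ26@3-BF-ERL-Ohta`.
[cite: YanZhu2024MainConjNonCM, Thm. 5.7 (1), Thm. 5.9, Def. 3.10 (arXiv:2412.20078)]
[cite: BurungaleCastellaKim2021, Thm. 5.2 = arXiv:1908.09512 Thm. 4.1] [cite: BurungaleCastellaSkinner2025, Prop. 4.2.2]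
[cite: CastellaGrossiLeeSkinner2022, Thm. 5.1.3, Rem. 4.1.4] -/
def Stmt.stub_compositeValuationThree_divisibleClassNumber : Prop :=
  ∀ (W : WeierstrassCurve ℚ) [W.IsElliptic] [W.IsGloballyMinimal] (p : ℕ) [Fact p.Prime],
    p = 3 → Literature.NumberTheory.EllipticCurves.Rank1Residual.GoodOrd W p →
    ∀ (K : Type) [Field K] [NumberField K], IsImaginaryQuadratic K →
      SatisfiesHeegnerHypothesis (W.conductorNorm ℤ) K → SatisfiesHeegnerHypothesis p K →
      Odd (NumberField.discr K) → NumberField.discr K ≠ -3 →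
      (W.baseChange K).HasIrreducibleModPGaloisRep p →
      p ∣ NumberField.classNumber K →
    ∀ (ι : K →+* ℚ_[p]) (v vbar : HeightOneSpectrum (𝓞 K)),
      (∀ x : 𝓞 K, x ∈ v.asIdeal ↔ ‖ι (x : K)‖ < 1) →
      ((p : ℕ) : 𝓞 K) ∈ vbar.asIdeal → vbar ≠ v →
    ∀ (κ : ZpExtension K p), κ.IsAnticyclotomic →
    ∀ (γ : absoluteGaloisGroup K) [Fact (κ.IsTopGenerator γ)],
    ∀ (N : ℕ) [NeZero N] (Dt : ModularParametrizationData W N)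
      (H : HeegnerDatum N (NumberField.discr K)) (ιC : K →+* ℂ) (P : (W.baseChange K).toAffine.Point),
      WeierstrassCurve.Affine.Point.map ιC.toRatAlgHom P = heegnerPointComplex Dt H →
      (∃ (jbar : AlgebraicClosure K →+* ℂ) (D : (W.baseChange K).LambdaAdicSelmerData κ γ)
          (F : HeegnerFamily N W K κ jbar) (X : (W.baseChange K).SelmerDualData κ γ),
          heegnerCharIdeal D F ^ 2 ≤
            Module.charIdeal (IwasawaAlgebra p) (Submodule.torsion (IwasawaAlgebra p) X.X)) →
    ∀ (G : IwasawaAlgebra p),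
      AcSelmer.XAc.charIdeal (W.baseChange K) p κ vbar ∅ γ = Ideal.span {G} →
      PowerSeries.constantCoeff G ≠ 0 →
      ∃ n : ℕ, AcSelmer.XAc.HasCharValuationAt (W.baseChange K) p κ vbar ∅ γ n ∧
        (n : ℤ) = 2 * ((padicValInt p (1 - W.frobeniusTrace p + p) : ℤ) - 1 +
          Literature.NumberTheory.EllipticCurves.padicLogOrd W p ι P) - 2 * (padicValInt p Dt.c : ℤ)

/-- **B₃⁰ — the same at `3 ∤ h_K`: PRINT modulo the cite-only composite fact**
`YanZhu2026.thm57_thm59_bcs422_cgls513_generator_constantCoeff_of_heegnerDivisibility` (valid as printed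
at every `p > 2`; proof-level flag `YZ26@3-BF-ERL-Ohta` at `3`) — in the kernel
`stub_compositeValuationThree_coprimeClassNumber_of_composite` below.
[cite: YanZhu2024MainConjNonCM, Thm. 5.7 (1), Thm. 5.9] [cite: BurungaleCastellaSkinner2025, Prop. 4.2.2]
[cite: CastellaGrossiLeeSkinner2022, Thm. 5.1.3] -/
def Stmt.stub_compositeValuationThree_coprimeClassNumber : Prop :=
  ∀ (W : WeierstrassCurve ℚ) [W.IsElliptic] [W.IsGloballyMinimal] (p : ℕ) [Fact p.Prime],
    p = 3 → Literature.NumberTheory.EllipticCurves.Rank1Residual.GoodOrd W p →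
    ∀ (K : Type) [Field K] [NumberField K], IsImaginaryQuadratic K →
      SatisfiesHeegnerHypothesis (W.conductorNorm ℤ) K → SatisfiesHeegnerHypothesis p K →
      Odd (NumberField.discr K) → NumberField.discr K ≠ -3 →
      (W.baseChange K).HasIrreducibleModPGaloisRep p →
      ¬ p ∣ NumberField.classNumber K →
    ∀ (ι : K →+* ℚ_[p]) (v vbar : HeightOneSpectrum (𝓞 K)),
      (∀ x : 𝓞 K, x ∈ v.asIdeal ↔ ‖ι (x : K)‖ < 1) →
      ((p : ℕ) : 𝓞 K) ∈ vbar.asIdeal → vbar ≠ v →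
    ∀ (κ : ZpExtension K p), κ.IsAnticyclotomic →
    ∀ (γ : absoluteGaloisGroup K) [Fact (κ.IsTopGenerator γ)],
    ∀ (N : ℕ) [NeZero N] (Dt : ModularParametrizationData W N)
      (H : HeegnerDatum N (NumberField.discr K)) (ιC : K →+* ℂ) (P : (W.baseChange K).toAffine.Point),
      WeierstrassCurve.Affine.Point.map ιC.toRatAlgHom P = heegnerPointComplex Dt H →
      (∃ (jbar : AlgebraicClosure K →+* ℂ) (D : (W.baseChange K).LambdaAdicSelmerData κ γ)
          (F : HeegnerFamily N W K κ jbar) (X : (W.baseChange K).SelmerDualData κ γ),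
          heegnerCharIdeal D F ^ 2 ≤
            Module.charIdeal (IwasawaAlgebra p) (Submodule.torsion (IwasawaAlgebra p) X.X)) →
    ∀ (G : IwasawaAlgebra p),
      AcSelmer.XAc.charIdeal (W.baseChange K) p κ vbar ∅ γ = Ideal.span {G} →
      PowerSeries.constantCoeff G ≠ 0 →
      ∃ n : ℕ, AcSelmer.XAc.HasCharValuationAt (W.baseChange K) p κ vbar ∅ γ n ∧
        (n : ℤ) = 2 * ((padicValInt p (1 - W.frobeniusTrace p + p) : ℤ) - 1 +
          Literature.NumberTheory.EllipticCurves.padicLogOrd W p ι P) - 2 * (padicValInt p Dt.c : ℤ)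

/-! ## The stubs (the ONLY sorries of the file) -/

theorem stub_compositeValuationThree_divisibleClassNumber :
    Stmt.stub_compositeValuationThree_divisibleClassNumber := by
  sorry

theorem stub_compositeValuationThree_coprimeClassNumber :
    Stmt.stub_compositeValuationThree_coprimeClassNumber := by
  sorry

/-! ## Composition (kernel-checked, no `sorry`) -/

/-- **B₃ ⇐ B₃¹ + B₃⁰ + the route's by-name item `JSWAnticyclotomicControl`** (JSW 2017 Thm. 3.3.1,
`p ≥ 3`, class-number-free). The σ-bridge of `PrintX9HowardIMCLink` §1 / bsd-idea-2's `B_birth`, ported: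
`ClassX10` supplies `p = 3`, `GoodOrd W p`; split on `3 ∣ h_K`. -/
theorem TwoSidedLinkAnyClassNumberX10b_of
    (h1 : Stmt.stub_compositeValuationThree_divisibleClassNumber)
    (h2 : Stmt.stub_compositeValuationThree_coprimeClassNumber)
    (h331 : Summit.BirchSwinnertonDyer.BirchSwinnertonDyer.Theses.PrintX10b.JSWAnticyclotomicControl) :
    Summit.BirchSwinnertonDyer.BirchSwinnertonDyer.Theses.PrintX10b.TwoSidedLinkAnyClassNumberX10b := by
  unfold Stmt.stub_compositeValuationThree_divisibleClassNumber at h1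
  unfold Stmt.stub_compositeValuationThree_coprimeClassNumber at h2
  have h331' : thm331_anticyclotomicControl := h331
  intro W _ _ p _ _ K _ _ hX hns hcm hK hodd h3 hHN hHp hirrK ι κ hκ γ _ Dt hc H ιC P hP hrk hfinp
    hPinf hHow
  have hp3 : p = 3 := hX.p_eq
  have hp : 3 ≤ p := hX.three_le
  obtain ⟨hgood, hord⟩ := id hX.goodOrd
  -- the other prime `w` above `p`, of degree one, and THE embedding at it
  obtain ⟨w, hw, hwne⟩ := X11b.exists_other_prime hHp (X11b.inducedPlace ι)
    (X11b.natCast_mem_inducedPlace ι)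
  have hsplit : X11b.SplitsIn K p := hHp p Fact.out (dvd_refl p)
  obtain ⟨he, hf⟩ := X11b.degreeOne_of_splitsIn hK.1 hsplit hw
  set ιw : K →+* ℚ_[p] := X11b.embAt K p w hw he hf with hιw
  -- a generator with non-zero constant term of the module strict at `v = inducedPlace ι`, from JSW
  obtain ⟨-, F, hF, hF0, -⟩ := h331' W p hp hgood K hK hHp hHN hirrK ι (X11b.inducedPlace ι)
    (X11b.mem_inducedPlace_iff ι) κ hκ γ hrk hfinp P hPinf
  -- the composite (B₃¹ or B₃⁰ by the class number) at the embedding `ιw`, strict prime `inducedPlace ι`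
  obtain ⟨n, hn, hval⟩ : ∃ n : ℕ,
      AcSelmer.XAc.HasCharValuationAt (W.baseChange K) p κ (X11b.inducedPlace ι) ∅ γ n ∧
        (n : ℤ) = 2 * ((padicValInt p (1 - W.frobeniusTrace p + p) : ℤ) - 1 +
          Literature.NumberTheory.EllipticCurves.padicLogOrd W p ιw P) - 2 * (padicValInt p Dt.c : ℤ) := by
    by_cases hhK : p ∣ NumberField.classNumber K
    · exact h1 W p hp3 ⟨hgood, hord⟩ K hK hHN hHp hodd h3 hirrK hhK ιw w (X11b.inducedPlace ι)
        (X11b.mem_asIdeal_iff_norm_embAt_lt_one w hw he hf) (X11b.natCast_mem_inducedPlace ι)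
        (fun h ↦ hwne h.symm) κ hκ γ (W.conductorNorm ℤ) Dt H ιC P hP hHow F hF hF0
    · exact h2 W p hp3 ⟨hgood, hord⟩ K hK hHN hHp hodd h3 hirrK hhK ιw w (X11b.inducedPlace ι)
        (X11b.mem_asIdeal_iff_norm_embAt_lt_one w hw he hf) (X11b.natCast_mem_inducedPlace ι)
        (fun h ↦ hwne h.symm) κ hκ γ (W.conductorNorm ℤ) Dt H ιC P hP hHow F hF hF0
  -- `ιw = ι ∘ σ` for an involution `σ`; the log valuations agree in rank one
  obtain ⟨σ, hσ, hισ⟩ := X11b.exists_involutive_comp_eq hK.1 ι ιw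
  have hlog : Literature.NumberTheory.EllipticCurves.padicLogOrd W p ιw P = X11b.padicLogOrd W p ι P := by
    rw [← hισ, ← X11b.padicLogOrd_eq_literature]
    exact padicLogOrd_comp_eq_of_rank_one W p (by omega) σ hσ ι hrk P hPinf
  have hc0 : padicValInt p Dt.c = 0 := padicValInt.eq_zero_of_not_dvd hc
  refine ⟨n, (X11b.AcSelmer.hasCharValuationAt_iff_literature _ p κ (X11b.inducedPlace ι) ∅ γ n).mpr hn,
    ?_⟩
  rw [hlog] at hval
  omega

/-- The composed line from the stubs and the by-name route item (sorries only through `stub_*`). -/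
theorem TwoSidedLinkAnyClassNumberX10b_of_stubs
    (h331 : Summit.BirchSwinnertonDyer.BirchSwinnertonDyer.Theses.PrintX10b.JSWAnticyclotomicControl) :
    Summit.BirchSwinnertonDyer.BirchSwinnertonDyer.Theses.PrintX10b.TwoSidedLinkAnyClassNumberX10b :=
  TwoSidedLinkAnyClassNumberX10b_of stub_compositeValuationThree_divisibleClassNumber
    stub_compositeValuationThree_coprimeClassNumber h331

/-! ## Kernel evidence for the transfer: the coprime regime is print, modulo the composite fact -/

/-- **`stub_compositeValuationThree_coprimeClassNumber` IS print** (modulo the composite named fact):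
`YanZhu2026.hasCharValuationAt_of_heegnerDivisibility` at `p = 3`.
[cite: YanZhu2024MainConjNonCM, Thm. 5.7 (1), Thm. 5.9] [cite: BurungaleCastellaSkinner2025, Prop. 4.2.2]
[cite: CastellaGrossiLeeSkinner2022, Thm. 5.1.3] -/
theorem stub_compositeValuationThree_coprimeClassNumber_of_composite
    (hYZ : thm57_thm59_bcs422_cgls513_generator_constantCoeff_of_heegnerDivisibility) :
    Stmt.stub_compositeValuationThree_coprimeClassNumber := by
  unfold Stmt.stub_compositeValuationThree_coprimeClassNumber
  intro W _ _ p _ hp3 hgo K _ _ hK hHN hHp hodd h3 hirrK hhK ι v vbar hv hvbar hne κ hκ γ _ N _ Dt H ιC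
    P hP hHow G hG hG0
  exact hasCharValuationAt_of_heegnerDivisibility hYZ (by omega) hgo K hK hHN hHp hodd h3 hirrK hhK ι v
    vbar hv hvbar hne κ hκ γ Dt H ιC P hP hHow G hG hG0

end Summit.BirchSwinnertonDyer.BirchSwinnertonDyer.Cruxes.TwoSidedLinkAnyClassNumberX10b.CompositeTransferX10b

end
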